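import Summits.QuantumFields.YangMills.Theorems.BalabanUVNodesK0Stub1DtColumnSocket
import HarnessLib

/-!
# K0⁷ STUB 1 (`stub_prop8StepCoP13`), sub-target S4b «the (δ∕δA′)V pieces at objects» — **THE (73)ᵀ COLUMN LETTER OF THE IMPLICIT CHART's DERIVATIVE FROM THE
# LETTERS OF THE REMAINDER's TRANSPOSE AND OF `Hᵀ`** (generic finite-dimensional algebra): if `𝔇 = C′∘(1 − H∘𝔇)` (implicit differentiation of (49)
# `D(A′) = C(A′ − H·D(A′))` at the dressed point), `Ct`, `Ht` transpose `C′`, `H` w.r.t. the pairings (27)∕block, and `Dt` is ANY transpose of `𝔇`, then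
# `Dt∘(1 + Ht∘Ct) = Ct` (nondegeneracy of (27)), `1 + Ht∘Ct` is onto with a weighted Neumann bound, and `w₃(b)‖Dt X b‖ ≤ 2θ_C·s` whenever `wB′‖X‖ ≤ s`,
# `w₃‖Ct X‖ ≤ θ_C·s`, `wB′‖Ht Z‖ ≤ h₀·s′`, `2h₀θ_C ≤ 1`

Cell `pub-ymgap`, width seat `pub-ymgap-k0-s1-w2` g5 (CLAIM-5 = part (β1) of k0-s1-w4 g2's LOCATED-♭-IMPLICIT-CHART repair, bus 2026-08-28 11:13Z ∕ 11:23Z).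
`--kind proof --supports stmt-QuantumFields-20541 --as helper`; count-neutral; def-free.  [15] = [Balaban1985Variational]; [B7] = [Balaban1985Averaging].

WHY.  k0-s1-w4 g2 LOCATED (11:13Z): the ♭ junctions p623337 ∕ p625916 instantiate this seat's chart Socket (p621022) at `Dfun := C♭ = chartLogFlat − D(chartLogFlat)(0)`, the
CONSTRAINT REMAINDER, whereas [15] (80)∕Sect. F is keyed on the (49)–(50) FIXED POINT `D♭` (`D♭(A′) = C♭(A′ − H♭D♭(A′))`, so that (48)♭ holds); their (α)
`…K0Stub1FlatChartDImplicit` supplies `Dsel♭` (UST `Chart47Analytic`).  The Socket's last letter `h73t(θ₀)` must then be produced for the transposes of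
`𝔇♭ = D(Dsel♭)(A′)`, which is NOT local but satisfies `𝔇♭ = C♭′_Φ∘(1 − H♭∘𝔇♭)` (`Φ = A′ − H♭D♭A′`).  THIS FILE is the instance-free half (β1): from the column
letter of the transposes of `C♭′_Φ` (this seat's p628026 `h73t_flat_T4` at the dressed point) and the (46)ᵀ row of `H♭ᵀ` (k0-s1-w4 p620776) to the column letter of
EVERY transpose of `𝔇♭`, with `θ₀ := 2θ_C`, by transposing the implicit relation and a weighted Neumann bound — no chart named.  (β2) (k0-s1-w4 g2) instantiates.

HOW.  Test the three transposition identities against `δ`: `BE(Dt X, δ) = B(X, 𝔇δ) = B(X, C′δ) − B(X, C′(H(𝔇δ))) = BE(Ct X, δ) − BE(Dt(Ht(Ct X)), δ)`, so by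
NONDEGENERACY of `BE` (§1: the (27) pairing `η^d·Σ_b τ(Y_b δ_b)` with a dualiser `ρ` of `τ` separates points, Hahn–Banach `NormedSpace.norm_le_dual_bound`)
`Dt X + Dt(Ht(Ct X)) = Ct X`, i.e. `Dt∘(1 + T) = Ct` with `T := Ht∘Ct` (§2).  `T` contracts the weighted sup size by `h₀θ_C ≤ ½`, so `1 + T` is injective, hence
(finite dimension, `LinearMap.surjective_of_injective`) onto, and `Y + TY = X` forces `‖Y‖_{wB′} ≤ 2‖X‖_{wB′}` (§2, a finite max); finally
`w₃(b)‖Dt X b‖ = w₃(b)‖Ct Y b‖ ≤ θ_C·2s` (§3).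

WHAT IS PROVED (sorry-free; no definition; axioms standard; finite index types `ι` (fine bonds), `κ` (index bonds, non-empty), fibre `𝔸` a normed ℂ-algebra,
finite-dimensional over ℂ in §2–§3).
* §1 ★ `eq_zero_of_forall_pairing_eq_zero` ∕ ★ `eq_of_forall_pairing_eq` — `BE Y δ = c·Σ_b τ(Y_b δ_b)` (`c ≠ 0`), `τ` tracial with dualiser `ρ` (`τ(ρℓ·X) = ℓX`):
  `(∀ δ, BE Y δ = 0) → Y = 0`; two maps with the same transposition identity agree (★ `transpose_unique`).
* §2 ★★ `transpose_comp_one_add_eq` — `𝔇 δ = C′(δ − H(𝔇δ))` + the three transposition identities ⇒ `∀ X, Dt (X + Ht (Ct X)) = Ct X`.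
  ★★ `weighted_neumann_solve` — weights `wB′ > 0`, letters `w₃‖Ct X‖ ≤ θ_C·s`, `wB′‖Ht Z‖ ≤ h₀·s′`, `2h₀θ_C ≤ 1`: for every `X` there is `Y` with `Y + Ht(Ct Y) = X` and
  `wB′ t‖Y t‖ ≤ 2s` whenever `wB′ t‖X t‖ ≤ s` (injective ⇒ surjective in finite dimension; the bound from a finite max).
* §3 ★★★ `column_letter_of_implicit_transpose` — all together: `(∀ t, wB′ t‖X t‖ ≤ s) → ∀ b, w₃ b‖Dt X b‖ ≤ (2θ_C)·s` for EVERY transpose `Dt` of `𝔇`.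
* §3 ★★★ `h73t_of_implicit_transposes` — the Socket's binder shape at the record's (27) pairing `BE = bondPair η d τ` (`c = η^d`, `ι = PBond P 0`, `κ = BondIdx D`): if at
  every base point `A′` with sizes `≤ r < ε` the derivative `fderiv ℂ Dfun A′` satisfies the implicit relation with SOME `C′ H` whose transposes carry the letters
  `θ_C·r`, `h₀` with `2h₀θ_Cε ≤ 1`, then `h73t` holds for ANY `Dt` with `BE (Dt A′ X) δ = B X (fderiv ℂ Dfun A′ δ)`, `θ₀ := 2θ_C`.
HONEST SCOPE.  Finite-dimensional linear algebra in the letters of p624155 ∕ p621022; NO chart, NO estimate of [15]∕[B7] asserted; the instance (β2) (`Dfun := Dsel♭`,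
`C′ := D(C♭)(Φ)`, `H := H♭`, letters from p628026 ∕ p620776) is k0-s1-w4 g2's; `stub_prop8StepCoP13` ∕ K0⁷ NOT closed; N07 NOT discharged; no summit statement is proved
by this seat; counts unmoved (28∕28 · 5∕27); one finite 𝕋⁴ programme at fixed ε — R4 closes the conditional finite-𝕋⁴ rung `BalabanLadder.UV` only, never the summit; the
YM mass gap (Clay) is NOT proved by any of this; nothing continuum ∕ ℝ⁴ ∕ OS.  No `sorry`, no `def`, no `instance`, no `notation`.

References: [15] (27) p.282, (45)–(49) p.285, (66) p.287, (72)–(73) p.289, (88)–(90) pp.291–292, Prop. 4 (98) p.293; [B7] Prop. 5 (157) pp.40–42.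
-/

set_option autoImplicit false

noncomputable section

open scoped BigOperators

namespace Summit.QuantumFields.YangMills.Theorems.K0Stub1TransposeNeumannLetter

open Literature.MathematicalPhysics.QuantumFieldTheory.Balaban1983to89
open B6SectADomainsV1 (Domains)
open B6SectAOperatorsV1 (BondIdx)
open B9Eq39Adjoint (bondPair)
open Summit.QuantumFields.YangMills.Theorems.K0Stub1PairingsAtExtensions (bondPair_PBond_eq_sum)

/-! ## §1  Nondegeneracy of the (27)-type pairing from a dualiser; uniqueness of transposes -/

section Nondegenerate

variable {ι : Type*} [Fintype ι] [DecidableEq ι] {𝔸 : Type*} [NormedRing 𝔸] [NormedAlgebra ℂ 𝔸]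

/-- ★ **THE (27)-TYPE PAIRING SEPARATES POINTS**: for a tracial `τ` with dualiser `ρ` (`τ(ρℓ·X) = ℓX`) and `BE Y δ = c·Σ_b τ(Y_b δ_b)` with `c ≠ 0`: if `BE Y δ = 0` for
every `δ`, then `Y = 0` — test against `δ := δ_b·ρℓ` to get `ℓ(Y_b) = 0` for every functional `ℓ`, then Hahn–Banach (`NormedSpace.norm_le_dual_bound`).
[cite: Balaban1985Variational, (27) p.282, (66) p.287] -/
theorem eq_zero_of_forall_pairing_eq_zero (τ : 𝔸 →L[ℂ] ℂ) (ρ : (𝔸 →L[ℂ] ℂ) →L[ℂ] 𝔸)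
    (hρ : ∀ (ℓ' : 𝔸 →L[ℂ] ℂ) (X : 𝔸), τ (ρ ℓ' * X) = ℓ' X) (hτ : ∀ a b : 𝔸, τ (a * b) = τ (b * a))
    {c : ℂ} (hc : c ≠ 0) {BE : (ι → 𝔸) → (ι → 𝔸) → ℂ} (hBE : ∀ Y δ, BE Y δ = c * ∑ b, τ (Y b * δ b))
    {Y : ι → 𝔸} (hY : ∀ δ, BE Y δ = 0) : Y = 0 := by
  funext b
  have hℓ : ∀ ℓ' : 𝔸 →L[ℂ] ℂ, ℓ' (Y b) = 0 := by
    intro ℓ'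
    have key := hY (Pi.single b (ρ ℓ'))
    rw [hBE, Finset.sum_eq_single b (fun b' _ hb' => by rw [Pi.single_eq_of_ne hb', mul_zero, map_zero])
      (fun h => absurd (Finset.mem_univ _) h), Pi.single_eq_same, hτ, hρ] at key
    rcases mul_eq_zero.mp key with h | h
    · exact absurd h hc
    · exact h
  have h0 : ‖Y b‖ ≤ 0 := NormedSpace.norm_le_dual_bound ℂ (Y b) le_rfl fun ℓ' => by rw [hℓ ℓ', norm_zero, zero_mul]
  exact norm_le_zero_iff.mp h0

/-- ★ **EQUALITY FROM EQUAL PAIRINGS**: `BE` additive in the first slot and separating ⇒ `(∀ δ, BE Y δ = BE Y′ δ) → Y = Y′`. [cite: Balaban1985Variational, (27) p.282] -/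
theorem eq_of_forall_pairing_eq (τ : 𝔸 →L[ℂ] ℂ) (ρ : (𝔸 →L[ℂ] ℂ) →L[ℂ] 𝔸)
    (hρ : ∀ (ℓ' : 𝔸 →L[ℂ] ℂ) (X : 𝔸), τ (ρ ℓ' * X) = ℓ' X) (hτ : ∀ a b : 𝔸, τ (a * b) = τ (b * a))
    {c : ℂ} (hc : c ≠ 0) (BE : (ι → 𝔸) →L[ℂ] (ι → 𝔸) →L[ℂ] ℂ) (hBE : ∀ Y δ, BE Y δ = c * ∑ b, τ (Y b * δ b))
    {Y Y' : ι → 𝔸} (hY : ∀ δ, BE Y δ = BE Y' δ) : Y = Y' := by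
  have h : Y - Y' = 0 :=
    eq_zero_of_forall_pairing_eq_zero τ ρ hρ hτ hc (BE := fun Y δ => BE Y δ) hBE fun δ => by
      show BE (Y - Y') δ = 0
      rw [map_sub, sub_apply, hY δ, sub_self]
  exact sub_eq_zero.mp h

/-- ★ **TRANSPOSES ARE UNIQUE**: two maps `T T′ : (κ → 𝔸) → (ι → 𝔸)` with the same transposition identity `BE (T X) δ = B X (𝔇 δ)` agree pointwise — so a letter proved
for ONE transpose of `𝔇` holds for the Socket's existential one. [cite: Balaban1985Variational, (27) p.282, (88)-(90) pp.291-292] -/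
theorem transpose_unique {κ : Type*} (τ : 𝔸 →L[ℂ] ℂ) (ρ : (𝔸 →L[ℂ] ℂ) →L[ℂ] 𝔸)
    (hρ : ∀ (ℓ' : 𝔸 →L[ℂ] ℂ) (X : 𝔸), τ (ρ ℓ' * X) = ℓ' X) (hτ : ∀ a b : 𝔸, τ (a * b) = τ (b * a))
    {c : ℂ} (hc : c ≠ 0) (BE : (ι → 𝔸) →L[ℂ] (ι → 𝔸) →L[ℂ] ℂ) (hBE : ∀ Y δ, BE Y δ = c * ∑ b, τ (Y b * δ b))
    {B : (κ → 𝔸) → (κ → 𝔸) → ℂ} {𝔇 : (ι → 𝔸) → (κ → 𝔸)} {T T' : (κ → 𝔸) → (ι → 𝔸)}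
    (hT : ∀ X δ, BE (T X) δ = B X (𝔇 δ)) (hT' : ∀ X δ, BE (T' X) δ = B X (𝔇 δ)) (X : κ → 𝔸) : T X = T' X :=
  eq_of_forall_pairing_eq τ ρ hρ hτ hc BE hBE fun δ => by rw [hT, hT']

end Nondegenerate

/-! ## §2  The transposed implicit relation and the weighted Neumann solve -/

section Neumann

variable {ι κ : Type*} [Fintype ι] [DecidableEq ι] [Fintype κ] {𝔸 : Type*} [NormedRing 𝔸] [NormedAlgebra ℂ 𝔸]

omit [Fintype κ] in
/-- ★★ **THE TRANSPOSED IMPLICIT RELATION**: if `𝔇 δ = C′(δ − H(𝔇 δ))` (implicit differentiation of (49) `D(A′) = C(A′ − H·D(A′))`), `Ct`, `Ht`, `Dt` transpose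
`C′`, `H`, `𝔇` (`BE (Ct X) δ = B X (C′δ)`, `BE Z (H X) = B (Ht Z) X`, `BE (Dt X) δ = B X (𝔇 δ)`), `B` bi-additive in its second slot and `BE` separating: then
`Dt (X + Ht (Ct X)) = Ct X` for every `X`, i.e. `Dt∘(1 + Ht∘Ct) = Ct`. [cite: Balaban1985Variational, (49) p.285, (72)-(73) p.289, (88)-(90) pp.291-292] -/
theorem transpose_comp_one_add_eq (τ : 𝔸 →L[ℂ] ℂ) (ρ : (𝔸 →L[ℂ] ℂ) →L[ℂ] 𝔸)
    (hρ : ∀ (ℓ' : 𝔸 →L[ℂ] ℂ) (X : 𝔸), τ (ρ ℓ' * X) = ℓ' X) (hτ : ∀ a b : 𝔸, τ (a * b) = τ (b * a))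
    {c : ℂ} (hc : c ≠ 0) (BE : (ι → 𝔸) →L[ℂ] (ι → 𝔸) →L[ℂ] ℂ) (hBE : ∀ Y δ, BE Y δ = c * ∑ b, τ (Y b * δ b))
    (B : (κ → 𝔸) →L[ℂ] (κ → 𝔸) →L[ℂ] ℂ)
    (C' 𝔇 : (ι → 𝔸) →L[ℂ] (κ → 𝔸)) (H : (κ → 𝔸) →ₗ[ℂ] (ι → 𝔸)) (himp : ∀ δ, 𝔇 δ = C' (δ - H (𝔇 δ)))
    (Ct : (κ → 𝔸) →L[ℂ] (ι → 𝔸)) (hCt : ∀ X δ, BE (Ct X) δ = B X (C' δ))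
    (Ht : (ι → 𝔸) →L[ℂ] (κ → 𝔸)) (hHt : ∀ Z X, BE Z (H X) = B (Ht Z) X)
    (Dt : (κ → 𝔸) →L[ℂ] (ι → 𝔸)) (hDt : ∀ X δ, BE (Dt X) δ = B X (𝔇 δ)) (X : κ → 𝔸) :
    Dt (X + Ht (Ct X)) = Ct X := by
  refine eq_of_forall_pairing_eq τ ρ hρ hτ hc BE hBE fun δ => ?_
  -- `BE(Dt(X + HtCtX), δ) = B(X, 𝔇δ) + B(HtCtX, 𝔇δ) = B(X, C′δ) − B(X, C′H𝔇δ) + BE(CtX, H𝔇δ) = B(X, C′δ) = BE(Ct X, δ)`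
  have h1 : BE (Dt (X + Ht (Ct X))) δ = B X (𝔇 δ) + B (Ht (Ct X)) (𝔇 δ) := by
    rw [map_add, map_add, add_apply, hDt, hDt]
  have h2 : B X (𝔇 δ) = B X (C' δ) - B X (C' (H (𝔇 δ))) := by
    conv_lhs => rw [himp δ]
    rw [map_sub, map_sub]
  have h3 : B (Ht (Ct X)) (𝔇 δ) = B X (C' (H (𝔇 δ))) := by rw [← hHt, hCt]
  rw [h1, h2, h3, sub_add_cancel, hCt]

omit [Fintype ι] [DecidableEq ι] in
/-- ★★ **THE WEIGHTED NEUMANN SOLVE** (finite dimension): with weights `wB′ > 0` on `κ`, `w₃ ≥ 0` on `ι`, letters `(∀ t, wB′ t‖X t‖ ≤ s) → ∀ b, w₃ b‖Ct X b‖ ≤ θ_C·s` and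
`(∀ b, w₃ b‖Z b‖ ≤ s′) → ∀ t, wB′ t‖Ht Z t‖ ≤ h₀·s′`, and `2h₀θ_C ≤ 1`: the map `Y ↦ Y + Ht(Ct Y)` is injective (a weighted-max argument), hence onto
(`LinearMap.surjective_of_injective`), and the solution of `Y + Ht(Ct Y) = X` obeys `wB′ t‖Y t‖ ≤ 2s` whenever `wB′ t‖X t‖ ≤ s`.
[cite: Balaban1985Variational, (46) p.285, (73) p.289, (89)-(90) p.292] -/
theorem weighted_neumann_solve [FiniteDimensional ℂ 𝔸] [Nonempty κ]
    (Ct : (κ → 𝔸) →L[ℂ] (ι → 𝔸)) (Ht : (ι → 𝔸) →L[ℂ] (κ → 𝔸))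
    (w₃ : ι → ℝ) (wB' : κ → ℝ) (hwB' : ∀ t, 0 < wB' t) {θC h₀ : ℝ}
    (hC : ∀ (X : κ → 𝔸) (s : ℝ), (∀ t, wB' t * ‖X t‖ ≤ s) → ∀ b, w₃ b * ‖Ct X b‖ ≤ θC * s)
    (hH : ∀ (Z : ι → 𝔸) (s' : ℝ), (∀ b, w₃ b * ‖Z b‖ ≤ s') → ∀ t, wB' t * ‖Ht Z t‖ ≤ h₀ * s')
    (hsmall : 2 * h₀ * θC ≤ 1) (X : κ → 𝔸) (s : ℝ) (hX : ∀ t, wB' t * ‖X t‖ ≤ s) :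
    ∃ Y : κ → 𝔸, Y + Ht (Ct Y) = X ∧ ∀ t, wB' t * ‖Y t‖ ≤ 2 * s := by
  classical
  -- the weighted max of a field and the contraction of `T = Ht∘Ct`
  have hmax : ∀ Y : κ → 𝔸, ∃ m : ℝ, 0 ≤ m ∧ (∀ t, wB' t * ‖Y t‖ ≤ m) ∧ ∃ t₀, wB' t₀ * ‖Y t₀‖ = m := by
    intro Y
    obtain ⟨t₀, -, ht₀⟩ := Finset.exists_max_image Finset.univ (fun t => wB' t * ‖Y t‖) Finset.univ_nonempty
    exact ⟨wB' t₀ * ‖Y t₀‖, mul_nonneg (hwB' t₀).le (norm_nonneg _), fun t => ht₀ t (Finset.mem_univ t), t₀, rfl⟩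
  have hT : ∀ (Y : κ → 𝔸) (m : ℝ), (∀ t, wB' t * ‖Y t‖ ≤ m) → ∀ t, wB' t * ‖Ht (Ct Y) t‖ ≤ m / 2 := by
    intro Y m hY t
    have h1 := hH (Ct Y) (θC * m) (hC Y m hY) t
    have hm : 0 ≤ m := by
      obtain ⟨t₁⟩ := ‹Nonempty κ›
      exact (mul_nonneg (hwB' t₁).le (norm_nonneg _)).trans (hY t₁)
    calc wB' t * ‖Ht (Ct Y) t‖ ≤ h₀ * (θC * m) := h1
      _ = (2 * h₀ * θC) * m / 2 := by ring
      _ ≤ 1 * m / 2 := by gcongr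
      _ = m / 2 := by ring
  -- the linear map `1 + T` is injective
  set F : (κ → 𝔸) →ₗ[ℂ] (κ → 𝔸) := LinearMap.id + ((Ht : (ι → 𝔸) →ₗ[ℂ] (κ → 𝔸)) ∘ₗ (Ct : (κ → 𝔸) →ₗ[ℂ] (ι → 𝔸))) with hF
  have hFapp : ∀ Y, F Y = Y + Ht (Ct Y) := fun Y => rfl
  have hinj : Function.Injective F := by
    intro Y₁ Y₂ h12
    have h0 : F (Y₁ - Y₂) = 0 := by rw [map_sub, h12, sub_self]
    rw [hFapp] at h0
    -- `Y = −T Y` with `‖TY‖ ≤ ‖Y‖∕2` forces `Y = 0`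
    set Y := Y₁ - Y₂ with hYdef
    obtain ⟨m, hm0, hYm, t₀, ht₀⟩ := hmax Y
    have hY' : Y = -(Ht (Ct Y)) := eq_neg_of_add_eq_zero_left h0
    have hnorm : ‖Y t₀‖ = ‖Ht (Ct Y) t₀‖ := by rw [congrFun hY' t₀, Pi.neg_apply, norm_neg]
    have hle : m ≤ m / 2 :=
      calc m = wB' t₀ * ‖Y t₀‖ := ht₀.symm
        _ = wB' t₀ * ‖Ht (Ct Y) t₀‖ := by rw [hnorm]
        _ ≤ m / 2 := hT Y m hYm t₀
    have hm : m = 0 := le_antisymm (by linarith) hm0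
    have hY0 : Y = 0 := by
      funext t
      have h1 : wB' t * ‖Y t‖ ≤ 0 := hm ▸ hYm t
      have h2 : ‖Y t‖ ≤ 0 := le_of_mul_le_mul_left (by rwa [mul_zero]) (hwB' t)
      exact norm_le_zero_iff.mp h2
    exact sub_eq_zero.mp hY0
  -- hence onto: solve `Y + T Y = X`
  obtain ⟨Y, hY⟩ := LinearMap.surjective_of_injective hinj X
  refine ⟨Y, by rw [← hFapp]; exact hY, ?_⟩
  -- the bound: `m(Y) ≤ s + m(Y)∕2`
  obtain ⟨m, hm0, hYm, t₀, ht₀⟩ := hmax Y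
  have hYX : Y = X - Ht (Ct Y) := eq_sub_of_add_eq (by rw [← hFapp]; exact hY)
  have hYt₀ : Y t₀ = X t₀ - Ht (Ct Y) t₀ := by rw [congrFun hYX t₀, Pi.sub_apply]
  have hmle : m ≤ s + m / 2 :=
    calc m = wB' t₀ * ‖Y t₀‖ := ht₀.symm
      _ = wB' t₀ * ‖X t₀ - Ht (Ct Y) t₀‖ := by rw [hYt₀]
      _ ≤ wB' t₀ * (‖X t₀‖ + ‖Ht (Ct Y) t₀‖) := mul_le_mul_of_nonneg_left (norm_sub_le _ _) (hwB' t₀).le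
      _ = wB' t₀ * ‖X t₀‖ + wB' t₀ * ‖Ht (Ct Y) t₀‖ := mul_add _ _ _
      _ ≤ s + m / 2 := add_le_add (hX t₀) (hT Y m hYm t₀)
  have hm2 : m ≤ 2 * s := by linarith
  exact fun t => (hYm t).trans hm2

end Neumann

/-! ## §3  The column letter of every transpose of the implicit derivative; the Socket's `h73t` binder shape -/

section Letter

variable {ι κ : Type*} [Fintype ι] [DecidableEq ι] [Fintype κ] {𝔸 : Type*} [NormedRing 𝔸] [NormedAlgebra ℂ 𝔸]

/-- ★★★ **THE COLUMN LETTER OF EVERY TRANSPOSE OF THE IMPLICIT DERIVATIVE.**  Separating (27)-type pairing `BE` (tracial `τ` with dualiser `ρ`, `c ≠ 0`), block pairing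
`B`, the implicit relation `𝔇 δ = C′(δ − H(𝔇δ))`, transposes `Ct` of `C′` and `Ht` of `H` with the letters `w₃‖Ct X‖ ≤ θ_C·s` (for `wB′‖X‖ ≤ s`) and
`wB′‖Ht Z‖ ≤ h₀·s′` (for `w₃‖Z‖ ≤ s′`), `2h₀θ_C ≤ 1`: EVERY `Dt` with `BE (Dt X) δ = B X (𝔇 δ)` obeys `(∀ t, wB′ t‖X t‖ ≤ s) → ∀ b, w₃ b‖Dt X b‖ ≤ (2θ_C)·s`
(`Dt X = Ct Y` for the Neumann solution `Y + Ht Ct Y = X`, `‖Y‖_{wB′} ≤ 2s`). [cite: Balaban1985Variational, (27) p.282, (49) p.285, (72)-(73) p.289, (88)-(90) pp.291-292, (98) p.293] -/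
theorem column_letter_of_implicit_transpose [FiniteDimensional ℂ 𝔸] [Nonempty κ]
    (τ : 𝔸 →L[ℂ] ℂ) (ρ : (𝔸 →L[ℂ] ℂ) →L[ℂ] 𝔸)
    (hρ : ∀ (ℓ' : 𝔸 →L[ℂ] ℂ) (X : 𝔸), τ (ρ ℓ' * X) = ℓ' X) (hτ : ∀ a b : 𝔸, τ (a * b) = τ (b * a))
    {c : ℂ} (hc : c ≠ 0) (BE : (ι → 𝔸) →L[ℂ] (ι → 𝔸) →L[ℂ] ℂ) (hBE : ∀ Y δ, BE Y δ = c * ∑ b, τ (Y b * δ b))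
    (B : (κ → 𝔸) →L[ℂ] (κ → 𝔸) →L[ℂ] ℂ)
    (C' 𝔇 : (ι → 𝔸) →L[ℂ] (κ → 𝔸)) (H : (κ → 𝔸) →ₗ[ℂ] (ι → 𝔸)) (himp : ∀ δ, 𝔇 δ = C' (δ - H (𝔇 δ)))
    (Ct : (κ → 𝔸) →L[ℂ] (ι → 𝔸)) (hCt : ∀ X δ, BE (Ct X) δ = B X (C' δ))
    (Ht : (ι → 𝔸) →L[ℂ] (κ → 𝔸)) (hHt : ∀ Z X, BE Z (H X) = B (Ht Z) X)
    (w₃ : ι → ℝ) (wB' : κ → ℝ) (hwB' : ∀ t, 0 < wB' t) {θC h₀ : ℝ}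
    (hC : ∀ (X : κ → 𝔸) (s : ℝ), (∀ t, wB' t * ‖X t‖ ≤ s) → ∀ b, w₃ b * ‖Ct X b‖ ≤ θC * s)
    (hH : ∀ (Z : ι → 𝔸) (s' : ℝ), (∀ b, w₃ b * ‖Z b‖ ≤ s') → ∀ t, wB' t * ‖Ht Z t‖ ≤ h₀ * s')
    (hsmall : 2 * h₀ * θC ≤ 1)
    (Dt : (κ → 𝔸) →L[ℂ] (ι → 𝔸)) (hDt : ∀ X δ, BE (Dt X) δ = B X (𝔇 δ))
    (X : κ → 𝔸) (s : ℝ) (hX : ∀ t, wB' t * ‖X t‖ ≤ s) (b : ι) :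
    w₃ b * ‖Dt X b‖ ≤ (2 * θC) * s := by
  obtain ⟨Y, hY, hYs⟩ := weighted_neumann_solve Ct Ht w₃ wB' hwB' hC hH hsmall X s hX
  have hDtX : Dt X = Ct Y := by
    rw [← hY]
    exact transpose_comp_one_add_eq τ ρ hρ hτ hc BE hBE B C' 𝔇 H himp Ct hCt Ht hHt Dt hDt Y
  rw [hDtX]
  calc w₃ b * ‖Ct Y b‖ ≤ θC * (2 * s) := hC Y (2 * s) hYs b
    _ = (2 * θC) * s := by ring

end Letter

/-! ## §3′  The binder shape of the Socket (`K0Stub1SectFWSlotAtRecordSocket` ∕ p623337) at the record's (27) pairing -/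

section Record

variable {P : Params} {𝔸 : Type*} [NormedRing 𝔸] [NormedAlgebra ℂ 𝔸] [FiniteDimensional ℂ 𝔸]

/-- ★★★ **`h73t` FOR EVERY TRANSPOSE OF AN IMPLICITLY DIFFERENTIATED CHART** — for every torus `P`, nested family `D` (index bonds non-empty), weights `w` with
`w 3 ≥ 0`, block weight `wB′ > 0`, fibre letters (`τ` tracial with dualiser `ρ`), `η ≠ 0`, the (27) pairing `BE = bondPair η d τ` and a block pairing `B`; a chart
`Dfun` whose derivative at every base point `A′` with sizes `≤ r < ε` satisfies `fderiv Dfun A′ δ = C′_{A′}(δ − H(fderiv Dfun A′ δ))` for SOME `ℂ`-linear `C′_{A′}`, `H`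
admitting transposes `Ct_{A′}`, `Ht` with the letters `w₃‖Ct_{A′} X‖ ≤ θ_C·r·s`, `wB′‖Ht Z‖ ≤ h₀·s′`, and `2·h₀·θ_C·ε ≤ 1`: THEN for ANY `Dt` with
`BE (Dt A′ X) δ = B X (fderiv Dfun A′ δ)` the Socket's binder holds — `(∀ i, wB′ i‖X i‖ ≤ s) → ∀ b, w 3 b‖Dt A′ X b‖ ≤ (2θ_C)·r·s`.
[cite: Balaban1985Variational, (27) p.282, (45)-(49) p.285, (72)-(73) p.289, (88)-(90) pp.291-292, Prop. 4 (98) p.293; Balaban1985Averaging, Prop. 5 (157) pp.40-42] -/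
theorem h73t_of_implicit_transposes [DecidableEq (PBond P 0)] (k : ℕ) (Dm : Domains P) [Nonempty (BondIdx Dm)]
    (w : ℕ → PBond P 0 → ℝ) (hw1 : ∀ b, 0 ≤ w 1 b)
    (τ : 𝔸 →L[ℂ] ℂ) (ρ : (𝔸 →L[ℂ] ℂ) →L[ℂ] 𝔸)
    (hρ : ∀ (ℓ' : 𝔸 →L[ℂ] ℂ) (X : 𝔸), τ (ρ ℓ' * X) = ℓ' X) (hτ : ∀ a b : 𝔸, τ (a * b) = τ (b * a))
    {η : ℝ} (hη : η ≠ 0)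
    (BE : (PBond P 0 → 𝔸) →L[ℂ] (PBond P 0 → 𝔸) →L[ℂ] ℂ)
    (hBE : ∀ Y δ : PBond P 0 → 𝔸, BE Y δ = bondPair η P.d (τ : 𝔸 →ₗ[ℂ] ℂ) (fun μ x => Y ⟨x, μ⟩) (fun μ x => δ ⟨x, μ⟩))
    (B : (BondIdx Dm → 𝔸) →L[ℂ] (BondIdx Dm → 𝔸) →L[ℂ] ℂ)
    (Dfun : (PBond P 0 → 𝔸) → (BondIdx Dm → 𝔸))
    (H : (BondIdx Dm → 𝔸) →ₗ[ℂ] (PBond P 0 → 𝔸)) (Ht : (PBond P 0 → 𝔸) →L[ℂ] (BondIdx Dm → 𝔸)) (hHt : ∀ Z X, BE Z (H X) = B (Ht Z) X)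
    (wB' : BondIdx Dm → ℝ) (hwB' : ∀ t, 0 < wB' t) {θC h₀ ε : ℝ} (hθC : 0 ≤ θC) (hh₀ : 0 ≤ h₀)
    (hH : ∀ (Z : PBond P 0 → 𝔸) (s' : ℝ), (∀ b, w 3 b * ‖Z b‖ ≤ s') → ∀ t, wB' t * ‖Ht Z t‖ ≤ h₀ * s')
    (hsmall : 2 * h₀ * θC * ε ≤ 1)
    (himp : ∀ (A' : PBond P 0 → 𝔸) (r : ℝ), (∀ b, w 1 b * ‖A' b‖ ≤ r) →
      (∀ (b : PBond P 0) (ν : Fin P.d), w 2 b * (P.L : ℝ) ^ k * ‖A' ⟨b.src.shift ν, b.dir⟩ - A' b‖ ≤ r) → r < ε →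
      ∃ (C' : (PBond P 0 → 𝔸) →L[ℂ] (BondIdx Dm → 𝔸)) (Ct : (BondIdx Dm → 𝔸) →L[ℂ] (PBond P 0 → 𝔸)),
        (∀ δ, fderiv ℂ Dfun A' δ = C' (δ - H (fderiv ℂ Dfun A' δ))) ∧ (∀ X δ, BE (Ct X) δ = B X (C' δ)) ∧
        ∀ (X : BondIdx Dm → 𝔸) (s : ℝ), (∀ t, wB' t * ‖X t‖ ≤ s) → ∀ b, w 3 b * ‖Ct X b‖ ≤ θC * r * s)
    (Dt : (PBond P 0 → 𝔸) → ((BondIdx Dm → 𝔸) →L[ℂ] (PBond P 0 → 𝔸)))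
    (hDt : ∀ (A' : PBond P 0 → 𝔸) X δ, BE (Dt A' X) δ = B X (fderiv ℂ Dfun A' δ)) :
    ∀ (A' : PBond P 0 → 𝔸) (r : ℝ), (∀ b, w 1 b * ‖A' b‖ ≤ r) →
      (∀ (b : PBond P 0) (ν : Fin P.d), w 2 b * (P.L : ℝ) ^ k * ‖A' ⟨b.src.shift ν, b.dir⟩ - A' b‖ ≤ r) → r < ε →
      ∀ (X : BondIdx Dm → 𝔸) (s : ℝ), (∀ i, wB' i * ‖X i‖ ≤ s) → ∀ b, w 3 b * ‖Dt A' X b‖ ≤ (2 * θC) * r * s := by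
  intro A' r h0 h1 hr X s hX b
  have hr0 : 0 ≤ r := le_trans (mul_nonneg (hw1 ⟨fun _ => 0, ⟨0, P.hd⟩⟩) (norm_nonneg _)) (h0 _)
  have hc : ((η : ℂ) ^ P.d) ≠ 0 := pow_ne_zero _ (by exact_mod_cast hη)
  have hBE' : ∀ Y δ : PBond P 0 → 𝔸, BE Y δ = (η : ℂ) ^ P.d * ∑ b, τ (Y b * δ b) := fun Y δ => by
    rw [hBE]; exact bondPair_PBond_eq_sum η (τ : 𝔸 →ₗ[ℂ] ℂ) Y δ
  obtain ⟨C', Ct, himp', hCt, hC⟩ := himp A' r h0 h1 hr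
  have hsmall' : 2 * h₀ * (θC * r) ≤ 1 := by
    have : θC * r ≤ θC * ε := mul_le_mul_of_nonneg_left hr.le hθC
    nlinarith [mul_nonneg hh₀ (mul_nonneg hθC hr0)]
  have h := column_letter_of_implicit_transpose (ι := PBond P 0) (κ := BondIdx Dm) τ ρ hρ hτ hc BE hBE' B C' (fderiv ℂ Dfun A') H himp'
    Ct hCt Ht hHt (w 3) wB' hwB' hC hH hsmall' (Dt A') (hDt A') X s hX b
  calc w 3 b * ‖Dt A' X b‖ ≤ (2 * (θC * r)) * s := h
    _ = (2 * θC) * r * s := by ring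

end Record

end Summit.QuantumFields.YangMills.Theorems.K0Stub1TransposeNeumannLetter

end
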